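import Literature.NumberTheory.GaloisRepresentations.ConjugationDescent
import Literature.NumberTheory.GaloisRepresentations.ContinuousRepHomDual
import Mathlib.RepresentationTheory.Intertwining
import HarnessLib

/-!
# Equivariant continuous homs `N → Hom(Z, Ω)` versus `Hom_G(Z, Y)` along `Y ≃ Hom_cont(N, Ω)`
# (cell `b2b-bsdres`, team n1011, row T-EPC = Tate's local Euler–Poincaré characteristic; seat p04 GEN 8; stage C3b)

HONEST FRAMING (cell `b2b-bsdres`, run/shared/lean/b2b/bsd-rank1-residual/, verbatim in every
file): the goal of the cell is to DELETE the COMBINATION-SHAPED residual classes of the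
Birch–Swinnerton-Dyer formula for ALL analytic-rank `≤ 1` elliptic curves over `ℚ` — "full BSD
formula for every rank `≤ 1` curve in class `C`" assembled STRICTLY from published theorems — so
that the rank-`≤ 1` remainder becomes exactly the CONSTRUCTION-SHAPED classes, which are TYPED
(missing-input `Prop`s), NOT attempted. This is not "finishing BSD". Team n1011 (N10 / N11, the
additive block X4 ∧ `p = 3`): research route; no claim beyond the stated classes; nothing is
booked; no mark / label is changed by this file. Theorems only (no definition, no named fact, no
`sorry`); TOOL theorems of profinite group cohomology.  (Placement: Summits/GaloisImage with the
T-EPC cone.)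

## What

The "swap" step of stage C of the T-EPC programme (Milne, *ADT* I Thm. 2.8, proof, p. 34:
`H¹(Gal(K̄/L), M) = Hom(Gal(K̄/L), M)` as a `G`-module, computed through `L^×/L^{×p}`).  Let `G` be a
topological group, `N ⊴ G`, `Ω` a discrete `G`-module and `Z` a finite discrete `G`-module on both
of which `N` acts trivially, and `Y` an abstract `G`-module given with an additive isomorphism
`Ψ : Y ≃ Z¹_cont(N, Ω)` (`= Hom_cont(N, Ω)`) which is `G`-equivariant for the conjugation action on
cocycles `(g·φ)(m) = g φ(g⁻¹ m g)` (for `Y = Eˣ/Eˣⁿ`, `Ω = μₙ` this is the equivariant Kummer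
isomorphism of stage C3a).  Then

* `EquivariantHom.natCard_invariant_cocycles_homRep_eq` —
  **`#{φ ∈ Z¹_cont(N, Hom(Z, Ω)) | g·φ = φ ∀ g} = #Hom_G(Z, Y)`**:
  `φ ↦ (z ↦ Ψ⁻¹(m ↦ φ(m)(z)))` and `Θ ↦ (m ↦ (z ↦ Ψ(Θ z)(m)))` are inverse bijections between the
  `G`-invariant continuous crossed homomorphisms `N → Hom(Z, Ω) = Z^D` (the tree's dual module
  `ContinuousRep.homRep`) and the `G`-equivariant additive maps `Z → Y`
  (`Representation.IntertwiningMap`).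

With stage C1 (`#H¹(G, M) = #{G-invariant φ : N → M}`), `M ≅ M^{DD}` and C3a this gives
`h¹(K, M) = #Hom_Γ(M^D, Eˣ/Eˣᵖ)`, to which Lemma 2.11 (stage B7) applies.

References: J. S. Milne, *Arithmetic Duality Theorems* (2006), I §2, proof of Thm. 2.8
[MilneADT2006]; J.-P. Serre, *Local Fields* (1979), VII §5 [SerreLocalFields1979].
-/

noncomputable section

open CategoryTheory Function
open Literature.NumberTheory.GaloisRepresentations
open Literature.NumberTheory.EllipticCurves (subgroupConj subgroupConj_apply_coe)

universe u

namespace Summit.BirchSwinnertonDyer.Rank1Residual.GaloisImage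

namespace EquivariantHom

variable {G : Type u} [Group G] [TopologicalSpace G] [IsTopologicalGroup G]
variable (N : Subgroup G) [N.Normal]
variable {Ω : Type u} [AddCommGroup Ω] [TopologicalSpace Ω] [DiscreteTopology Ω]
  (ω : ContinuousRep G ℤ Ω)
variable {Z : Type u} [AddCommGroup Z] [TopologicalSpace Z] [DiscreteTopology Z] [Finite Z]
  (ζ : ContinuousRep G ℤ Z)
variable {Y : Type*} [AddCommGroup Y] (τ : Representation ℤ G Y)

omit [IsTopologicalGroup G] [N.Normal] [TopologicalSpace Z] [DiscreteTopology Z] in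
/-- A map `N → Hom(Z, Ω)` (`Z` finite, `Hom(Z, Ω)` discrete) is continuous as soon as all its
evaluations `m ↦ f m z` are. [folklore] -/
theorem continuous_of_eval (f : N → HomCarrier Z Ω) (hf : ∀ z : Z, Continuous fun m => f m z) :
    Continuous f := by
  classical
  haveI := Fintype.ofFinite Z
  rw [continuous_discrete_rng]
  intro F
  have hset : f ⁻¹' {F} = ⋂ z : Z, (fun m => f m z) ⁻¹' {F z} := by
    ext m
    simp only [Set.mem_preimage, Set.mem_singleton_iff, Set.mem_iInter]
    exact ⟨fun h z => by rw [h], fun h => HomCarrier.ext h⟩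
  rw [hset]
  exact isOpen_iInter_of_finite fun z => (continuous_discrete_rng.1 (hf z)) (F z)

omit [N.Normal] in
/-- **Evaluation at `z ∈ Z`** takes a continuous cocycle `φ : N → Hom(Z, Ω) = Z^D` to a continuous
cocycle `m ↦ φ(m)(z) : N → Ω`, when `N` acts trivially on `Z`. [folklore] -/
theorem exists_eval (hZ : ∀ n ∈ N, ∀ z : Z, ζ n z = z)
    (φ : contOneCocycles (subgroupRep (ζ.homRep ω).toTopRep N)) (z : Z) :
    ∃ ψ : contOneCocycles (subgroupRep ω.toTopRep N), ∀ m : N, ψ.1 m = φ.1 m z := by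
  refine ⟨⟨⟨fun m => φ.1 m z,
    (continuous_of_discreteTopology (f := fun F : HomCarrier Z Ω => F z)).comp φ.1.continuous⟩,
    fun m m' => ?_⟩, fun m => rfl⟩
  change φ.1 (m * m') z = φ.1 m z + ω (m : G) (φ.1 m' z)
  rw [φ.2 m m', subgroupRep_ρ_apply]
  change (φ.1 m + (ζ.homRep ω) (m : G) (φ.1 m')) z = _
  rw [HomCarrier.add_apply, ContinuousRep.homRep_apply_apply_apply]
  have h : ζ (m : G)⁻¹ z = z := by
    have := hZ (m : G)⁻¹ (N.inv_mem m.2) z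
    exact this
  rw [h]

/-- **`#{G-invariant φ ∈ Z¹_cont(N, Z^D)} = #Hom_G(Z, Y)`** along a `G`-equivariant additive
isomorphism `Ψ : Y ≃ Z¹_cont(N, Ω)`, for `N ⊴ G` acting trivially on the finite discrete `Z` and on
the discrete `Ω` (`Z^D = Hom(Z, Ω)` the tree's `homRep`; `(g·φ)(m) = g φ(g⁻¹ m g)`).
[cite: MilneADT2006, I §2 proof of Thm 2.8 (p. 34)] [cite: SerreLocalFields1979, VII §5] -/
theorem natCard_invariant_cocycles_homRep_eq
    (hΩ : ∀ n ∈ N, ∀ v : Ω, ω n v = v) (hZ : ∀ n ∈ N, ∀ z : Z, ζ n z = z)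
    (Ψ : Y ≃+ contOneCocycles (subgroupRep ω.toTopRep N))
    (hΨ : ∀ (g : G) (y : Y), Ψ (τ g y) =
      contOneCocycles.pullback (subgroupConj N g) (conjRepHom ω.toTopRep N g) (Ψ y)) :
    Nat.card {φ : contOneCocycles (subgroupRep (ζ.homRep ω).toTopRep N) //
        ∀ g : G, contOneCocycles.pullback (subgroupConj N g)
          (conjRepHom (ζ.homRep ω).toTopRep N g) φ = φ} =
      Nat.card (Representation.IntertwiningMap ζ.toRepresentation τ) := by
  classical
  -- evaluation cocycles
  choose ev hev using exists_eval N ω ζ hZ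
  have hev_add : ∀ (φ : contOneCocycles (subgroupRep (ζ.homRep ω).toTopRep N)) (z z' : Z),
      ev φ (z + z') = ev φ z + ev φ z' := fun φ z z' => by
    apply Subtype.ext; ext m
    change (ev φ (z + z')).1 m = (ev φ z).1 m + (ev φ z').1 m
    rw [hev, hev, hev, map_add]
  -- values of `Ψ y` under conjugation
  have hΨval : ∀ (g : G) (y : Y) (m : N),
      (Ψ y).1 m = ω g ((Ψ (τ g⁻¹ y)).1 (subgroupConj N g m)) := fun g y m => by
    have h := hΨ g (τ g⁻¹ y)
    rw [← Module.End.mul_apply, ← map_mul, mul_inv_cancel, map_one, Module.End.one_apply] at h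
    conv_lhs => rw [h]
    rfl
  -- inverse direction `Θ ↦ φ_Θ`
  have hΘcoc : ∀ Θ : Representation.IntertwiningMap ζ.toRepresentation τ,
      ∃ φ : contOneCocycles (subgroupRep (ζ.homRep ω).toTopRep N),
        ∀ (m : N) (z : Z), φ.1 m z = (Ψ (Θ z)).1 m := by
    intro Θ
    let f : N → HomCarrier Z Ω := fun m =>
      HomCarrier.ofAddMonoidHom
        { toFun := fun z => (Ψ (Θ z)).1 m
          map_zero' := by
            rw [map_zero, map_zero]; rfl
          map_add' := fun z z' => by
            rw [map_add, map_add]; rfl }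
    have hf : ∀ m z, f m z = (Ψ (Θ z)).1 m := fun m z => rfl
    have hfc : Continuous f := continuous_of_eval N (fun m => f m) fun z => (Ψ (Θ z)).1.continuous
    refine ⟨⟨⟨f, hfc⟩, fun m m' => HomCarrier.ext fun z => ?_⟩, fun m z => rfl⟩
    change f (m * m') z = (f m + (ζ.homRep ω) (m : G) (f m')) z
    rw [HomCarrier.add_apply, ContinuousRep.homRep_apply_apply_apply, hf, hf, hf,
      (Ψ (Θ z)).2 m m', subgroupRep_ρ_apply]
    have h1 : ζ (m : G)⁻¹ z = z := hZ (m : G)⁻¹ (N.inv_mem m.2) z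
    rw [h1]
    change _ + ω (m : G) _ = _ + ω (m : G) _
    rw [hΩ (m : G) m.2]
  choose coc hcoc using hΘcoc
  -- the bijection
  refine Nat.card_congr
    { toFun := fun φ =>
        { toLinearMap := (AddMonoidHom.mk' (fun z => Ψ.symm (ev φ.1 z))
            (fun z z' => by rw [hev_add, map_add])).toIntLinearMap
          isIntertwining' := fun g => by
            refine LinearMap.ext fun z => ?_
            change Ψ.symm (ev φ.1 (ζ g z)) = τ g (Ψ.symm (ev φ.1 z))
            apply Ψ.injective
            rw [Ψ.apply_symm_apply, hΨ, Ψ.apply_symm_apply]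
            apply Subtype.ext; ext m
            rw [hev, conj_pullback_apply]
            change φ.1.1 m (ζ g z) = ω g ((ev φ.1 z).1 (subgroupConj N g m))
            rw [hev]
            have hφ := congrArg
              (fun ψ : contOneCocycles (subgroupRep (ζ.homRep ω).toTopRep N) => ψ.1 m (ζ g z)) (φ.2 g)
            rw [← hφ]
            change ω g (φ.1.1 (subgroupConj N g m) (ζ g⁻¹ (ζ g z))) = _
            rw [← Module.End.mul_apply, ← map_mul, inv_mul_cancel, map_one, Module.End.one_apply] }
      invFun := fun Θ => ⟨coc Θ, fun g => by
        apply Subtype.ext; ext m z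
        rw [conj_pullback_apply]
        change ω g ((coc Θ).1 (subgroupConj N g m) (ζ g⁻¹ z)) = (coc Θ).1 m z
        have hΘ : Θ (ζ g⁻¹ z) = τ g⁻¹ (Θ z) := Θ.isIntertwining _ _ g⁻¹ z
        rw [hcoc, hcoc, hΨval g (Θ z) m, hΘ]⟩
      left_inv := fun φ => by
        apply Subtype.ext; apply Subtype.ext; ext m z
        change (coc _).1 m z = φ.1.1 m z
        rw [hcoc]
        change (Ψ (Ψ.symm (ev φ.1 z))).1 m = _
        rw [Ψ.apply_symm_apply, hev]
      right_inv := fun Θ => by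
        refine Representation.IntertwiningMap.ext (LinearMap.ext fun z => ?_)
        change Ψ.symm (ev (coc Θ) z) = Θ z
        apply Ψ.injective
        rw [Ψ.apply_symm_apply]
        apply Subtype.ext; ext m
        rw [hev, hcoc] }

end EquivariantHom

/-! ### Variant with unified module structure and a bijective additive map

For `Y` a quotient of a `ℤ`-module by a submodule the `Module ℤ Y` instance carried by a
`Representation ℤ G Y` is `Submodule.Quotient.module`, not `AddCommGroup.toIntModule`; the variant
below takes the module structure of `Y` as an implicit (unified) argument and `Ψ` as a bijective
`→+`, which is the form produced by the equivariant Kummer isomorphism (stage C3a). -/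

namespace EquivariantHom

variable {G : Type u} [Group G] [TopologicalSpace G] [IsTopologicalGroup G]
variable (N : Subgroup G) [N.Normal]
variable {Ω : Type u} [AddCommGroup Ω] [TopologicalSpace Ω] [DiscreteTopology Ω]
  (ω : ContinuousRep G ℤ Ω)
variable {Z : Type u} [AddCommGroup Z] [TopologicalSpace Z] [DiscreteTopology Z] [Finite Z]
  (ζ : ContinuousRep G ℤ Z)

/-- **`#{G-invariant φ ∈ Z¹_cont(N, Z^D)} = #Hom_G(Z, Y)`** along a `G`-equivariant BIJECTIVE
additive map `Ψ : Y → Z¹_cont(N, Ω)`, for `N ⊴ G` acting trivially on the finite discrete `Z` and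
on the discrete `Ω`; the `ℤ`-module structure of `Y` is the one carried by the representation `τ`.
[cite: MilneADT2006, I §2 proof of Thm 2.8 (p. 34)] [cite: SerreLocalFields1979, VII §5] -/
theorem natCard_invariant_cocycles_homRep_eq_of_bijective
    {Y : Type*} {instY : AddCommGroup Y} {instM : Module ℤ Y} (τ : Representation ℤ G Y)
    (hΩ : ∀ n ∈ N, ∀ v : Ω, ω n v = v) (hZ : ∀ n ∈ N, ∀ z : Z, ζ n z = z)
    (Ψ : Y →+ contOneCocycles (subgroupRep ω.toTopRep N)) (hbij : Bijective Ψ)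
    (hΨ : ∀ (g : G) (y : Y), Ψ (τ g y) =
      contOneCocycles.pullback (subgroupConj N g) (conjRepHom ω.toTopRep N g) (Ψ y)) :
    Nat.card {φ : contOneCocycles (subgroupRep (ζ.homRep ω).toTopRep N) //
        ∀ g : G, contOneCocycles.pullback (subgroupConj N g)
          (conjRepHom (ζ.homRep ω).toTopRep N g) φ = φ} =
      Nat.card (Representation.IntertwiningMap ζ.toRepresentation τ) := by
  -- all `ℤ`-module structures on `Y` coincide
  obtain rfl : instM = AddCommGroup.toIntModule Y := Subsingleton.elim _ _
  exact natCard_invariant_cocycles_homRep_eq N ω ζ τ hΩ hZ (AddEquiv.ofBijective Ψ hbij)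
    fun g y => hΨ g y

end EquivariantHom

end Summit.BirchSwinnertonDyer.Rank1Residual.GaloisImage

end
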